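import Summits.KontsevichZagierPeriods.KontsevichZagierPeriods.Theorems.LinRedNormalFormArrangementNormalFormSeparateAllHHSector
import Summits.KontsevichZagierPeriods.KontsevichZagierPeriods.Theorems.LinRedNormalFormArrangementNormalFormSeparateAllHHWeight
import Summits.KontsevichZagierPeriods.KontsevichZagierPeriods.Theorems.LinRedNormalFormArrangementNormalFormSeparateAllHHRay

/-!
# The sector theorem: the Taylor pieces have finite mass on every small nested sector

(Line `janus-bands`, crux `ArrangementNormalForm`, stub `stub_separateHigh_hH`, part `AllHHSecMain` of
the dimension-generic wall-invariant termwise-split lemma, base dimension `b + 1 ≥ 4` with fibres;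
namespace `SepAll`.)
THE SECTOR THEOREM (`sector_finite`, registered as `separateAllHH_secMain`), uniform in the base
dimension and WITHOUT case analysis on the direction: at a point `z₁` of the closure of the
effective base `Y`, for an independent frame `f` containing a VERTICAL vector `f l₀'`, the density
`g = 𝟙_Y (∑_{i<N} |Ri i|) · m` of the Taylor pieces against the fibre mass has finite integral over
the nested sector `nsec z₁ f δ` for every scale `δ` below an explicit bound. Proof: a small sector
misses `Y` (zero) or lies inside (`SepAll.in_or_out`); inside, in blown-up coordinates (chart of part
`AllHHChart`) the density is `∑ᵢ |Tᵢ(w)| · W(w)` with the weight `W = wt Dv ω Λ'` of part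
`AllHHWeight` (walls factorised by part `AllHHSector`, fibre mass `Λ'` almost decreasing with
logarithmic costs) and the tensor polynomials `Tᵢ = pevn (tens (Gpiece i))` of part `AllHHForms`;
the total `∑ Tᵢ` is `W`-integrable on the big box (global finiteness); the variables with
`Dv = 0` are free, and by `SepAll.common_factor` the loaded ones sit at levels `≤ j⋆` at a pole
point (none otherwise), so the matching hypothesis of the ray theorem `SepAll.ray` holds by
`SepAll.match_pole` (resp. trivially); hence every piece is `W`-integrable on the small box.
-/

noncomputable section

open Set Finset MeasureTheory Filter Topology Function
open scoped ENNReal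

namespace Summit.KontsevichZagierPeriods.ArrangementNormalForm.JanusBands

namespace SepAll

open SepTwo MvPolynomial

variable {k b mL m'' : ℕ}

/-! ### Frames -/

/-- Frame combinations are the frame matrix applied to the coefficients. -/
theorem sum_smul_eq_mulVec (f : Fin (b + 1) → Fin (b + 1) → ℝ) (s : Fin (b + 1) → ℝ) :
    (∑ l', s l' • f l') = (fmat f).mulVec s := by
  funext i
  simp [Matrix.mulVec, dotProduct, fmat, Finset.sum_apply, smul_eq_mul, mul_comm]

/-- An independent frame has an invertible frame matrix. -/
theorem det_fmat_ne_zero {f : Fin (b + 1) → Fin (b + 1) → ℝ} (hf : LinearIndependent ℝ f) :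
    (fmat f).det ≠ 0 := by
  have hcol : (fmat f).col = f := by funext j i; rfl
  have h : LinearIndependent ℝ (fmat f).col := by rw [hcol]; exact hf
  have hu := Matrix.linearIndependent_cols_iff_isUnit.1 h
  rw [Matrix.isUnit_iff_isUnit_det] at hu
  exact hu.ne_zero

/-- Every base point has frame coordinates. -/
theorem exists_frame_coords {f : Fin (b + 1) → Fin (b + 1) → ℝ} (hf : LinearIndependent ℝ f)
    (z₁ x : Fin (b + 1) → ℝ) : ∃ s, fpt z₁ f s = x := by
  have hdet : IsUnit (fmat f).det := isUnit_iff_ne_zero.2 (det_fmat_ne_zero hf)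
  refine ⟨(fmat f)⁻¹.mulVec (x - z₁), ?_⟩
  rw [fpt, sum_smul_eq_mulVec, Matrix.mulVec_mulVec, Matrix.mul_nonsing_inv _ hdet, Matrix.one_mulVec]
  abel

/-- **The total numerator in frame coordinates is non-zero** if the numerator is. -/
theorem total_ne_zero (l : Fin b → ℝ) (l₀ : ℝ) (z₁ : Fin (b + 1) → ℝ) {f : Fin (b + 1) → Fin (b + 1) → ℝ}
    (hf : LinearIndependent ℝ f) {l₀' : Fin (b + 1)} (hvert : ∀ k', f l₀' (Fin.castSucc k') = 0)
    (N : ℕ) (q : ℕ → MvPolynomial (Fin b) ℝ)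
    (hnz : ∃ x₀, (∑ i ∈ range N, eval (pr x₀) (q i) * lam l l₀ x₀ ^ i) ≠ 0) :
    (∑ i ∈ range N, Gpiece l l₀ z₁ f l₀' q i) ≠ 0 := by
  obtain ⟨x₀, hx₀⟩ := hnz
  obtain ⟨s₀, hs₀⟩ := exists_frame_coords hf z₁ x₀
  intro h0
  have h := congrArg (MvPolynomial.eval s₀) h0
  rw [map_sum, map_zero] at h
  simp_rw [eval_Gpiece l l₀ z₁ f hvert q s₀, hs₀] at h
  exact hx₀ h

/-- A non-zero frame polynomial has a non-zero tensor entry. -/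
theorem exists_tens_ne_zero {P : MvPolynomial (Fin (b + 1)) ℝ} (hP : P ≠ 0) {d : ℕ}
    (hd : P.totalDegree ≤ d) : ∃ e', tens P d e' ≠ 0 := by
  obtain ⟨γ, hγ⟩ := ne_zero_iff.1 hP
  exact ⟨_, tens_trunc_ne_zero hd (mem_support_iff.2 hγ)⟩

/-- **Two-sided bounds for a regular factor near the corner.** -/
theorem omega_bounds {ω : (Fin (b + 1) → ℝ) → ℝ} (hωc : Continuous ω) (hω0 : ω 0 ≠ 0) :
    ∃ ρ₂ : ℝ, 0 < ρ₂ ∧ ∀ w : Fin (b + 1) → ℝ, (∀ j, |w j| < ρ₂) →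
      |ω 0| / 2 ≤ |ω w| ∧ |ω w| ≤ 2 * |ω 0| := by
  have hpos : 0 < |ω 0| / 2 := by positivity
  obtain ⟨ρ₂, hρ₂, h⟩ := Metric.continuousAt_iff.1 hωc.continuousAt (|ω 0| / 2) hpos
  refine ⟨ρ₂, hρ₂, fun w hw => ?_⟩
  have hd : dist w 0 < ρ₂ := by
    rw [dist_zero_right, pi_norm_lt_iff hρ₂]
    intro j; rw [Real.norm_eq_abs]; exact hw j
  have h1 : |ω w - ω 0| < |ω 0| / 2 := by
    have := h hd; rwa [Real.dist_eq] at this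
  constructor
  · have := abs_sub_abs_le_abs_sub (ω 0) (ω w)
    rw [abs_sub_comm] at this
    linarith
  · have := abs_add_le (ω w - ω 0) (ω 0)
    rw [sub_add_cancel] at this
    linarith [abs_nonneg (ω 0)]

/-- The vertical frame vector has a non-zero pole slope. -/
theorem lamL_vert (l : Fin b → ℝ) {f : Fin (b + 1) → Fin (b + 1) → ℝ} (hf : LinearIndependent ℝ f)
    {l₀' : Fin (b + 1)} (hvert : ∀ k', f l₀' (Fin.castSucc k') = 0) : lamL l (f l₀') ≠ 0 := by
  have hne : f l₀' ≠ 0 := hf.ne_zero l₀'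
  have hlast : f l₀' (Fin.last b) ≠ 0 := by
    intro h
    refine hne (funext fun i => ?_)
    refine Fin.lastCases ?_ (fun k' => ?_) i
    · exact h
    · exact hvert k'
  unfold lamL
  rw [Finset.sum_eq_zero fun i _ => by rw [hvert i, mul_zero], sub_zero]
  exact hlast

/-! ### The sector theorem -/

/-- **The sector theorem.** See the module docstring. -/
theorem sector_finite (φ : Fin m'' → (Fin (b + 1) → ℝ) × ℝ)
    (lo hi : Fin k → Fin k ⊕ Atm (b + 1)) (a : Fin k → Option (Atm (b + 1)))
    (κ : Fin mL → Fin b → ℝ) (μ : Fin mL → ℝ) (e : Fin mL → ℕ) (n : ℕ) (l : Fin b → ℝ) (l₀ : ℝ)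
    (N : ℕ) (q : ℕ → MvPolynomial (Fin b) ℝ)
    (R : (Fin (b + 1) → ℝ) → ℝ) (Ri : ℕ → (Fin (b + 1) → ℝ) → ℝ)
    (hR : ∀ x, R x = (∑ i ∈ range N, eval (pr x) (q i) * lam l l₀ x ^ i) / common κ μ e n l l₀ x)
    (hRi : ∀ i, i < N → ∀ x, Ri i x = eval (pr x) (q i) * lam l l₀ x ^ i / common κ μ e n l l₀ x)
    (hfinY : ∫⁻ x in {x | ∀ j, 0 < rav x (φ j)}, ENNReal.ofReal |R x| * lmass lo hi a (av x) < ∞)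
    (hκ0 : ∀ j, e j ≠ 0 → κ j = 0 → μ j ≠ 0)
    (hH' : ∀ j, e j ≠ 0 → ∀ x ∈ closure {x | ∀ j, 0 < rav x (φ j)}, lval κ μ j x = 0 →
      n ≠ 0 ∧ lam l l₀ x = 0)
    (hnz : ∃ x₀, (∑ i ∈ range N, eval (pr x₀) (q i) * lam l l₀ x₀ ^ i) ≠ 0)
    (z₁ : Fin (b + 1) → ℝ) (hz₁ : z₁ ∈ closure {x | ∀ j, 0 < rav x (φ j)})
    (f : Fin (b + 1) → Fin (b + 1) → ℝ) (hf : LinearIndependent ℝ f) (l₀' : Fin (b + 1))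
    (hvert : ∀ k', f l₀' (Fin.castSucc k') = 0) :
    ∃ δmax : ℝ, 0 < δmax ∧ ∀ δ : Fin (b + 1) → ℝ, (∀ l', 0 < δ l' ∧ δ l' ≤ δmax) →
      ∫⁻ x in nsec z₁ f δ, {x | ∀ j, 0 < rav x (φ j)}.indicator
        (fun x => (∑ i ∈ range N, ENNReal.ofReal |Ri i x|) * lmass lo hi a (av x)) x < ∞ := by
  classical
  set Y : Set (Fin (b + 1) → ℝ) := {x | ∀ j, 0 < rav x (φ j)} with hY
  have hYm : MeasurableSet Y := measurableSet_Y φ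
  set m : (Fin (b + 1) → ℝ) → ℝ≥0∞ := fun x => lmass lo hi a (av x) with hm
  set g : (Fin (b + 1) → ℝ) → ℝ≥0∞ := Y.indicator fun x => (∑ i ∈ range N, ENNReal.ofReal |Ri i x|) * m x
    with hg
  have hdet : (fmat f).det ≠ 0 := det_fmat_ne_zero hf
  obtain ⟨ρ₁, hρ₁, hio⟩ := in_or_out φ z₁ f
  rcases hio with hin | hout
  swap
  · -- the sector misses the base
    refine ⟨ρ₁, hρ₁, fun δ hδ => ?_⟩
    rw [lintegral_nsec z₁ f hdet δ g]
    have h0 : ∫⁻ w in box δ, ENNReal.ofReal (jac w) * g (z₁ + npt f w) = 0 := by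
      rw [setLIntegral_congr_fun (measurableSet_box δ) (fun w hw => ?_)]
      · exact lintegral_zero
      have hw' : ∀ j, 0 < w j ∧ w j ≤ ρ₁ := fun j =>
        ⟨(mem_box.1 hw j).1, (mem_box.1 hw j).2.le.trans (hδ j).2⟩
      rw [hg, indicator_of_notMem (hout w hw'), mul_zero]
    rw [h0, mul_zero]
    exact ENNReal.zero_lt_top
  -- the sector lies inside the base
  obtain ⟨ρ₀, hρ₀, KΛ, hKΛ, Kn, CΛ, hCΛ, hΛmono, hΛlog⟩ := weight_hyps lo hi a z₁ f
  obtain ⟨jstar, hlow, hjs⟩ := exists_pole_level l hf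
  obtain ⟨Dv, ω, hωc, hω0, hcommon, hlevel⟩ :=
    common_factor κ μ e n l l₀ hκ0 hH' z₁ hz₁ f hf hρ₁ hin jstar hlow hjs
  obtain ⟨ρ₂, hρ₂, hωbd⟩ := omega_bounds hωc hω0
  refine ⟨min (min ρ₁ ρ₀) ρ₂ / 4, by positivity, fun δ hδ => ?_⟩
  have h4 : ∀ j, 4 * δ j ≤ ρ₁ ∧ 4 * δ j ≤ ρ₀ ∧ 4 * δ j ≤ ρ₂ := by
    intro j
    have := (hδ j).2
    have h1 := min_le_left (min ρ₁ ρ₀) ρ₂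
    have h2 := min_le_right (min ρ₁ ρ₀) ρ₂
    have h3 := min_le_left ρ₁ ρ₀
    have h4 := min_le_right ρ₁ ρ₀
    refine ⟨by linarith, by linarith, by linarith⟩
  have hbig_in : ∀ w : Fin (b + 1) → ℝ, (∀ j, 0 < w j ∧ w j < 4 * δ j) → z₁ + npt f w ∈ Y :=
    fun w hw => hin w fun j => ⟨(hw j).1, by linarith [(hw j).2, (h4 j).1]⟩
  -- the weight
  set Λ' : (Fin (b + 1) → ℝ) → ℝ≥0∞ := fun w => lmass lo hi a (av (z₁ + npt f w)) with hΛ'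
  have hWm : Measurable (wt Dv ω Λ') := measurable_wt Dv hωc (measurable_lmass_npt lo hi a z₁ f)
  have hωbig : ∀ w : Fin (b + 1) → ℝ, (∀ j, 0 < w j ∧ w j < 4 * δ j) →
      |ω 0| / 2 ≤ |ω w| ∧ |ω w| ≤ 2 * |ω 0| :=
    fun w hw => hωbd w fun j => by rw [abs_of_pos (hw j).1]; linarith [(hw j).2, (h4 j).2.2]
  have hωlo : 0 < |ω 0| / 2 := by positivity
  have hmono := wt_mono Dv hωlo hωbig KΛ
    (fun w w' hw hww' hw'w hw' => hΛmono w w' hw hww' hw'w fun j => by linarith [hw' j, (h4 j).2.1])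
  set Free : Finset (Fin (b + 1)) := univ.filter fun l' => Dv l' = 0 with hFree
  have hlog : ∀ i ∈ Free, ∀ w : Fin (b + 1) → ℝ, (∀ l', 0 < w l' ∧ w l' < δ l') → ∀ x', w i ≤ x' →
      x' < δ i → wt Dv ω Λ' w ≤ (ENNReal.ofReal ((2 * |ω 0|) / (|ω 0| / 2)) * CΛ) *
        ENNReal.ofReal ((1 + Real.log (x' / w i)) ^ Kn) * wt Dv ω Λ' (update w i x') := by
    intro i hi
    have hDi : Dv i = 0 := (Finset.mem_filter.1 hi).2
    exact wt_log Dv hωlo hωbig i hDi Kn CΛ fun w hw x' hx hx' => hΛlog i w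
      (fun j => ⟨(hw j).1, by linarith [(hw j).2, (hδ j).2, (h4 j).2.1, (hδ j).1]⟩) x' hx
      (by linarith [(hδ i).2, (h4 i).2.1, (hδ i).1])
  have hK : ENNReal.ofReal ((4 : ℝ) ^ (∑ l', Dv l') * ((2 * |ω 0|) / (|ω 0| / 2))) * KΛ ≠ ∞ :=
    ENNReal.mul_ne_top ENNReal.ofReal_ne_top hKΛ
  have hC : ENNReal.ofReal ((2 * |ω 0|) / (|ω 0| / 2)) * CΛ ≠ ∞ := ENNReal.mul_ne_top ENNReal.ofReal_ne_top hCΛ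
  -- the numerator tensors
  set G : ℕ → MvPolynomial (Fin (b + 1)) ℝ := Gpiece l l₀ z₁ f l₀' q with hG
  set d : ℕ := (∑ i ∈ range N, G i).totalDegree + ∑ i ∈ range N, (G i).totalDegree with hd
  have hdt : (∑ i ∈ range N, G i).totalDegree ≤ d := Nat.le_add_right _ _
  have hdi : ∀ i, i < N → (G i).totalDegree ≤ d := fun i hi =>
    (Finset.single_le_sum (f := fun i => (G i).totalDegree) (fun _ _ => Nat.zero_le _)
      (mem_range.2 hi)).trans (Nat.le_add_left _ _)
  have hlamv : lamL l (f l₀') ≠ 0 := lamL_vert l hf hvert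
  have hevG : ∀ i, i < N → ∀ w, pevn (tens (G i) d) w =
      eval (pr (z₁ + npt f w)) (q i) * lam l l₀ (z₁ + npt f w) ^ i := fun i hi w => by
    rw [pevn_tens (hdi i hi), hG, eval_Gpiece l l₀ z₁ f hvert q, fpt_cum]
  have hevT : ∀ w, pevn (tens (∑ i ∈ range N, G i) d) w =
      ∑ i ∈ range N, eval (pr (z₁ + npt f w)) (q i) * lam l l₀ (z₁ + npt f w) ^ i := fun w => by
    rw [pevn_tens hdt, map_sum]
    refine Finset.sum_congr rfl fun i _ => ?_
    rw [hG, eval_Gpiece l l₀ z₁ f hvert q, fpt_cum]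
  -- pointwise conversions on the big box
  have hωne : ∀ w : Fin (b + 1) → ℝ, (∀ j, 0 < w j ∧ w j < 4 * δ j) → ω w ≠ 0 := fun w hw =>
    abs_pos.1 (hωlo.trans_le (hωbig w hw).1)
  have hconvT : ∀ w : Fin (b + 1) → ℝ, (∀ j, 0 < w j ∧ w j < 4 * δ j) →
      ENNReal.ofReal (jac w) * (ENNReal.ofReal |R (z₁ + npt f w)| * Λ' w) =
        ENNReal.ofReal |pevn (tens (∑ i ∈ range N, G i) d) w| * wt Dv ω Λ' w := fun w hw => by
    rw [hR, ← hevT w]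
    exact piece_eq_wt Dv ω Λ' (fun j => (hw j).1) (hωne w hw) _ _ (hcommon w)
  have hconvI : ∀ i, i < N → ∀ w : Fin (b + 1) → ℝ, (∀ j, 0 < w j ∧ w j < 4 * δ j) →
      ENNReal.ofReal (jac w) * (ENNReal.ofReal |Ri i (z₁ + npt f w)| * Λ' w) =
        ENNReal.ofReal |pevn (tens (G i) d) w| * wt Dv ω Λ' w := fun i hi w hw => by
    rw [hRi i hi, ← hevG i hi w]
    exact piece_eq_wt Dv ω Λ' (fun j => (hw j).1) (hωne w hw) _ _ (hcommon w)
  -- global finiteness of the total on the big box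
  have hfin : ∫⁻ w in box (fun l' => 4 * δ l'),
      ENNReal.ofReal |pevn (tens (∑ i ∈ range N, G i) d) w| * wt Dv ω Λ' w < ∞ := by
    have h1 := lintegral_nsec z₁ f hdet (fun l' => 4 * δ l') (Y.indicator fun x => ENNReal.ofReal |R x| * m x)
    have h2 : ∫⁻ w in box (fun l' => 4 * δ l'), ENNReal.ofReal (jac w) *
        (Y.indicator (fun x => ENNReal.ofReal |R x| * m x)) (z₁ + npt f w) =
        ∫⁻ w in box (fun l' => 4 * δ l'), ENNReal.ofReal |pevn (tens (∑ i ∈ range N, G i) d) w| *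
          wt Dv ω Λ' w := by
      refine setLIntegral_congr_fun (measurableSet_box _) fun w hw => ?_
      rw [indicator_of_mem (hbig_in w (mem_box.1 hw))]
      exact hconvT w (mem_box.1 hw)
    have h3 : ∫⁻ x in nsec z₁ f (fun l' => 4 * δ l'), Y.indicator (fun x => ENNReal.ofReal |R x| * m x) x ≤
        ∫⁻ x in Y, ENNReal.ofReal |R x| * m x :=
      calc ∫⁻ x in nsec z₁ f (fun l' => 4 * δ l'), Y.indicator (fun x => ENNReal.ofReal |R x| * m x) x
          ≤ ∫⁻ x, Y.indicator (fun x => ENNReal.ofReal |R x| * m x) x := setLIntegral_le_lintegral _ _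
        _ = ∫⁻ x in Y, ENNReal.ofReal |R x| * m x := lintegral_indicator hYm _
    have h5 : ENNReal.ofReal |(fmat f).det| * ∫⁻ w in box (fun l' => 4 * δ l'),
        ENNReal.ofReal |pevn (tens (∑ i ∈ range N, G i) d) w| * wt Dv ω Λ' w < ∞ := by
      rw [← h2, ← h1]; exact h3.trans_lt hfinY
    have hdet0 : ENNReal.ofReal |(fmat f).det| ≠ 0 := by
      rw [ENNReal.ofReal_ne_zero_iff]; exact abs_pos.2 hdet
    rcases ENNReal.mul_lt_top_iff.1 h5 with h | h | h
    · exact h.2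
    · exact absurd h hdet0
    · rw [h]; exact ENNReal.zero_lt_top
  -- every piece is integrable on the small box
  have hpiece : ∀ i, i < N → ∫⁻ w in box δ, ENNReal.ofReal |pevn (tens (G i) d) w| * wt Dv ω Λ' w < ∞ := by
    intro i hi
    refine ray (wt Dv ω Λ') hWm _ hK Kn _ hC δ (fun l' => (hδ l').1) Free hmono hlog
      (tens (∑ i ∈ range N, G i) d) hfin (tens (G i) d) fun ee hee => ?_
    by_cases hpole : n ≠ 0 ∧ lam l l₀ z₁ = 0
    · obtain ⟨e', he', hmatch⟩ := match_pole l l₀ z₁ f l₀' jstar hpole.2 hlow hlamv N q d hdt hdi hi hee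
      refine ⟨e', he', fun l' hl' => ?_⟩
      have hDv : Dv l' ≠ 0 := fun h0 => hl' (Finset.mem_filter.2 ⟨Finset.mem_univ _, h0⟩)
      exact (hmatch l' (hlevel l' hDv).2).le
    · have hfree : ∀ l', l' ∈ Free := fun l' => Finset.mem_filter.2 ⟨Finset.mem_univ _, by
        by_contra h0; exact hpole (hlevel l' h0).1⟩
      obtain ⟨e', he'⟩ := exists_tens_ne_zero (total_ne_zero l l₀ z₁ hf hvert N q hnz) hdt
      exact ⟨e', he', fun l' hl' => absurd (hfree l') hl'⟩
  -- assemble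
  rw [lintegral_nsec z₁ f hdet δ g]
  refine ENNReal.mul_lt_top ENNReal.ofReal_lt_top ?_
  have hsmall : ∀ w ∈ box δ, ∀ j, 0 < w j ∧ w j < 4 * δ j := fun w hw j =>
    ⟨(mem_box.1 hw j).1, by linarith [(mem_box.1 hw j).2, (hδ j).1]⟩
  have hconvg : ∀ w ∈ box δ, ENNReal.ofReal (jac w) * g (z₁ + npt f w) =
      ∑ i ∈ range N, ENNReal.ofReal |pevn (tens (G i) d) w| * wt Dv ω Λ' w := by
    intro w hw
    rw [hg, indicator_of_mem (hbig_in w (hsmall w hw)), Finset.sum_mul, Finset.mul_sum]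
    exact Finset.sum_congr rfl fun i hi => hconvI i (mem_range.1 hi) w (hsmall w hw)
  have hmeas : ∀ i ∈ range N, Measurable fun w : Fin (b + 1) → ℝ =>
      ENNReal.ofReal |pevn (tens (G i) d) w| * wt Dv ω Λ' w := fun i _ =>
    (ENNReal.measurable_ofReal.comp (continuous_pevn _).measurable.abs).mul hWm
  rw [setLIntegral_congr_fun (measurableSet_box δ) hconvg, lintegral_finsetSum _ hmeas]
  exact ENNReal.sum_lt_top.2 fun i hi => hpiece i (mem_range.1 hi)

end SepAll

/-- **The sector theorem, any base dimension** (registered part of `stub_separateHigh_hH`; literal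
form of `SepAll.sector_finite`): at a point `z₁` of the closure of the effective base, for an
independent frame `f` with a vertical vector `f l₀'`, the density of the Taylor pieces against the
fibre mass has finite integral over the nested thin sector `nsec z₁ f δ` for every positive scale
`δ` below an explicit bound. -/
theorem separateAllHH_secMain (k b mL m'' : ℕ) (φ : Fin m'' → (Fin (b + 1) → ℝ) × ℝ) (lo hi : Fin k → Fin k ⊕ ((Fin (b + 1) → ℚ) × ℚ)) (a : Fin k → Option ((Fin (b + 1) → ℚ) × ℚ)) (κ : Fin mL → Fin b → ℝ) (μ : Fin mL → ℝ) (e : Fin mL → ℕ) (n : ℕ) (l : Fin b → ℝ) (l₀ : ℝ) (N : ℕ) (q : ℕ → MvPolynomial (Fin b) ℝ) (R : (Fin (b + 1) → ℝ) → ℝ) (Ri : ℕ → (Fin (b + 1) → ℝ) → ℝ) (hR : ∀ x, R x = (∑ i ∈ Finset.range N, MvPolynomial.eval (SepAll.pr x) (q i) * SepAll.lam l l₀ x ^ i) / SepAll.common κ μ e n l l₀ x) (hRi : ∀ i, i < N → ∀ x, Ri i x = MvPolynomial.eval (SepAll.pr x) (q i) * SepAll.lam l l₀ x ^ i / SepAll.common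 κ μ e n l l₀ x) (hfinY : MeasureTheory.lintegral (MeasureTheory.volume.restrict {x | ∀ j, 0 < SepAll.rav x (φ j)}) (fun x => ENNReal.ofReal |R x| * SepTwo.lmass lo hi a (SepTwo.av x)) < ⊤) (hκ0 : ∀ j, e j ≠ 0 → κ j = 0 → μ j ≠ 0) (hH' : ∀ j, e j ≠ 0 → ∀ x ∈ closure {x | ∀ j, 0 < SepAll.rav x (φ j)}, SepAll.lval κ μ j x = 0 → n ≠ 0 ∧ SepAll.lam l l₀ x = 0) (hnz : ∃ x₀, (∑ i ∈ Finset.range N, MvPolynomial.eval (SepAll.pr x₀) (q i) * SepAll.lam l l₀ x₀ ^ i) ≠ 0) (z₁ : Fin (b + 1) → ℝ) (hz₁ : z₁ ∈ closure {x | ∀ j, 0 < SepAll.rav x (φ j)}) (f : Fin (b + 1) → Fin (b + 1) → ℝ) (hf : LinearIndependent ℝ f) (l₀' : Fin (b + 1)) (hvert : ∀ k', f l₀' (Fin.castSucc k') = 0) : ∃ δmax : ℝ, 0 < δmax ∧ ∀ δ : Fin (b + 1) → ℝ, (∀ l', 0 < δ l' ∧ δ l' ≤ δmax) → MeasureTheory.lintegral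 (MeasureTheory.volume.restrict (SepAll.nsec z₁ f δ)) ({x | ∀ j, 0 < SepAll.rav x (φ j)}.indicator (fun x => (∑ i ∈ Finset.range N, ENNReal.ofReal |Ri i x|) * SepTwo.lmass lo hi a (SepTwo.av x))) < ⊤ := by
  exact SepAll.sector_finite φ lo hi a κ μ e n l l₀ N q R Ri hR hRi hfinY hκ0 hH' hnz z₁ hz₁ f hf l₀' hvert

end Summit.KontsevichZagierPeriods.ArrangementNormalForm.JanusBands
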